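import Literature.Geometry.PolyhedralFans.RegularRefinement
import Literature.Geometry.PolyhedralFans.MultiStarSubdivision
import HarnessLib

/-!
# Synchronised multiplicity descent: star subdivisions at several parallelotope points at once

Topic: `Literature/Geometry/PolyhedralFans` (continuation of `RegularRefinement` and
`MultiStarSubdivision`). W. Fulton, *Introduction to Toric Varieties* [Fulton1993Toric], §2.6
p. 48 (proof of the Proposition: "take a lattice point `v` of the fundamental parallelotope of a
cone of maximal multiplicity and subdivide; the new cones have smaller multiplicity"; Exercise:
"the multiplicities of the subdivided cones are `tᵢ · mult(σ)`") and G. Ewald, *Combinatorial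
Convexity and Algebraic Geometry* [Ewald1996], VI Thm. 8.5 (proof: induction on the maximal
multiplicity and the number of cones attaining it); G. Kempf et al., *Toroidal Embeddings I*
[KempfEtAl1973], Ch. II §2 (the same for conical polyhedral complexes, where the subdivision must
be performed compatibly with all face identifications — i.e. SIMULTANEOUSLY at all points of an
orbit). The tree's `Fan.exists_step` (RegularRefinement) CHOOSES one point; here the point is
PRESCRIBED, and a whole separated family of such points is subdivided at once:

* `Fan.isPrimSimplicial_starSubdivision_of_isPrimitive` — the star subdivision of a primitively
  simplicial fan through a primitive vector of its support is primitively simplicial;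
* `Fan.conePMult_starSubdivision_parPoint` — **one prescribed step**: if all counts are `≤ m`
  and `w` is a primitive parallelotope point of a cone `σ` of count `m`, then after the star
  subdivision through `w` all counts are `≤ m` and the cones of count `m` are old cones not
  containing `w`;
* `Fan.multiStep_parPoints` — **synchronised step**: the same for the iterated star subdivision
  through a SEPARATED finite family of such points (in any order): primitively simplicial, all
  counts `≤ m`, cones of count `m` are old cones containing none of the points;
* `Fan.multiStep_measure_lt` — hence the measure `(maxPMult, numMax)` drops lexicographically;
* `Fan.exists_parPoint_of_not_isRegular` — the choice behind one step (a primitive parallelotope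
  point of a cone of maximal count), exposed for the synchronised loop;
* `Fan.starCoord_congr` — the `v`-coordinate only depends on the set of cones (for comparing a
  fan with a transported fan having the same cones);
* `Fan.exists_regular_starIter_of_invariant` — the synchronised regularisation LOOP in abstract
  form: any invariant `I` preserved by one synchronised step at a separated family of maximal-count
  parallelotope points survives to a regular refinement (induction on `(maxPMult, numMax)`).

References: [Fulton1993Toric] §2.6 p. 48; [Ewald1996] VI Thm. 8.5; [KempfEtAl1973] Ch. I §2
Thm. 11, Ch. II §2.
-/

noncomputable section

namespace Literature.Geometry.PolyhedralFans

open PointedCone Finset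

variable {κ : Type*}

namespace Fan

/-! ## The `v`-coordinate only depends on the set of cones -/

section Congr

variable {𝕜 : Type*} [Field 𝕜] [LinearOrder 𝕜] [IsStrictOrderedRing 𝕜]

/-- Star decompositions only depend on the set of cones of the fan.
[cite: KempfEtAl1973, I §2 Thm. 11 proof, Lemma 2 (b)] -/
theorem isStarDecomp_congr {Δ₁ Δ₂ : Fan 𝕜 (κ → 𝕜)} (h : Δ₁.cones = Δ₂.cones) {v x : κ → 𝕜}
    {c : 𝕜} : Δ₁.IsStarDecomp v x c ↔ Δ₂.IsStarDecomp v x c := by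
  simp only [IsStarDecomp, h]

/-- The `v`-coordinate only depends on the set of cones of the fan (used to compare a fan with a
transported fan having the same cones). [cite: KempfEtAl1973, I §2 Thm. 11 proof, Lemma 2 (b)] -/
theorem starCoord_congr {Δ₁ Δ₂ : Fan 𝕜 (κ → 𝕜)} (h : Δ₁.cones = Δ₂.cones) (v x : κ → 𝕜) :
    Δ₁.starCoord v x = Δ₂.starCoord v x := by
  by_cases hex : ∃ c, Δ₁.IsStarDecomp v x c
  · obtain ⟨c, hc⟩ := hex
    rw [starCoord_eq_of_isStarDecomp hc, starCoord_eq_of_isStarDecomp ((isStarDecomp_congr h).1 hc)]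
  · have hex' : ¬ ∃ c, Δ₂.IsStarDecomp v x c := by
      rintro ⟨c, hc⟩; exact hex ⟨c, (isStarDecomp_congr h).2 hc⟩
    rw [starCoord, dif_neg hex, starCoord, dif_neg hex']

end Congr

section Step

variable [Fintype κ] [DecidableEq κ]

omit [DecidableEq κ] in
/-- The star subdivision of a primitively simplicial fan through a PRIMITIVE vector is
primitively simplicial (the new cones `τ + ℚ_{≥0} w`, `w ∉ τ ≤ σ ∋ w`, are hulls of the
linearly independent set `T ∪ {w}`). Extracted from the proof of `Fan.exists_step`.
[cite: Fulton1993Toric, §2.6 p. 48] -/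
theorem isPrimSimplicial_starSubdivision_of_isPrimitive {Δ : Fan ℚ (κ → ℚ)}
    (hΔ : Δ.IsPrimSimplicial) {w : κ → ℚ} (hw : IsPrimitive w) :
    (Δ.starSubdivision w).IsPrimSimplicial := by
  intro ρ' hρ'
  rw [starSubdivision_cones] at hρ'
  rcases mem_starCones_iff.mp hρ' with ⟨hρ'Δ, -⟩ | ⟨τ, hτ, hwτ, ⟨σ'', hσ'', hτσ'', hwσ''⟩, rfl⟩
  · exact hΔ hρ'Δ
  · obtain ⟨T, hTU, hliT, hτT⟩ := hΔ hτ
    refine ⟨insert w T, ?_, ?_, ?_⟩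
    · rw [Finset.coe_insert]; exact Set.insert_subset hw hTU
    · rw [Finset.coe_insert]
      refine hliT.id_insert fun hwspan => hwτ ?_
      have hface : τ.IsFaceOf σ'' := isFaceOf_of_le hσ'' hτ hτσ''
      refine mem_of_isFaceOf_of_mem_span hface hwσ'' ?_
      rwa [hτT, span_coe_hull]
    · rw [Finset.coe_insert, hull_insert, ← hτT]

/-- **One prescribed regularisation step** ([Fulton1993Toric] §2.6 p. 48; [Ewald1996] VI 8.5):
in a primitively simplicial fan all of whose cones have count `≤ m`, let `σ` be a cone of count
`m` with primitive simplicial generators `S` and `w = Σ a_s s` a PRIMITIVE parallelotope point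
(`a ∈ parCoeffs S`). Then every cone of the star subdivision through `w` has count `≤ m`, and
those of count exactly `m` are cones of the original fan not containing `w` (the new cones have
count `< m` by `pmult_insert_lt_of_mem`). Extracted from the proof of `Fan.exists_step`, with the
point prescribed instead of chosen. [cite: Fulton1993Toric, §2.6 p. 48] -/
theorem conePMult_starSubdivision_parPoint {Δ : Fan ℚ (κ → ℚ)} (hΔ : Δ.IsPrimSimplicial)
    {m : ℕ} (hm : ∀ ρ ∈ Δ.cones, conePMult ρ ≤ m) {σ : PointedCone ℚ (κ → ℚ)} (hσ : σ ∈ Δ.cones)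
    {S : Finset (κ → ℚ)} (hS : IsPrimGens σ S) (hσm : conePMult σ = m)
    {a : (κ → ℚ) → ℚ} (ha : a ∈ parCoeffs S) (hw : IsPrimitive (∑ s ∈ S, a s • s))
    {ρ' : PointedCone ℚ (κ → ℚ)} (hρ' : ρ' ∈ (Δ.starSubdivision (∑ s ∈ S, a s • s)).cones) :
    conePMult ρ' ≤ m ∧
      (conePMult ρ' = m → ρ' ∈ Δ.cones ∧ (∑ s ∈ S, a s • s) ∉ ρ') := by
  set w := ∑ s ∈ S, a s • s with hwdef
  rw [starSubdivision_cones] at hρ'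
  rcases mem_starCones_iff.mp hρ' with ⟨hρ'Δ, hwρ'⟩ | ⟨τ, hτ, hwτ, ⟨σ'', hσ'', hτσ'', hwσ''⟩, rfl⟩
  · exact ⟨hm ρ' hρ'Δ, fun _ => ⟨hρ'Δ, hwρ'⟩⟩
  · obtain ⟨S'', hS''⟩ := hΔ.exists_isPrimGens hσ''
    obtain ⟨T, hT⟩ := hΔ.exists_isPrimGens hτ
    have hnew : IsPrimGens (τ ⊔ ray ℚ w) (insert w T) := by
      refine ⟨?_, ?_, ?_⟩
      · intro s hs
        rcases Finset.mem_insert.mp hs with rfl | hs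
        · exact hw
        · exact hT.1 s hs
      · rw [Finset.coe_insert]
        refine hT.2.1.id_insert fun hwspan => hwτ ?_
        have hface : τ.IsFaceOf σ'' := isFaceOf_of_le hσ'' hτ hτσ''
        refine mem_of_isFaceOf_of_mem_span hface hwσ'' ?_
        rwa [hT.2.2, span_coe_hull]
      · rw [Finset.coe_insert, hull_insert, ← hT.2.2]
    have hlt : conePMult (τ ⊔ ray ℚ w) < m := by
      rw [conePMult_eq hnew]
      calc pmult (insert w T) < pmult S'' :=
            pmult_insert_lt_of_mem hσ hσ'' hτ hτσ'' hS hS'' hT ha hwσ'' hwτ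
        _ = conePMult σ'' := (conePMult_eq hS'').symm
        _ ≤ m := hm σ'' hσ''
    have _ := hσm
    exact ⟨hlt.le, fun h => absurd h hlt.ne⟩

/-- **Synchronised regularisation step** ([KempfEtAl1973] II §2; [Fulton1993Toric] §2.6
p. 48): let `Δ` be primitively simplicial with all counts `≤ m`, and `l` a duplicate-free list
of points SEPARATED by `Δ` (no cone contains two of them), each a primitive parallelotope
point of SOME cone of count `m`. Then the iterated star subdivision `Δ.starIter l` (in the given
— by `Fan.starIter_cones_eq_of_separated` in any — order) is primitively simplicial, all its
counts are `≤ m`, and its cones of count `m` are cones of `Δ` containing none of the points (the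
later points' cones are untouched by the earlier subdivisions). [cite: Fulton1993Toric, §2.6 p. 48] -/
theorem multiStep_parPoints {m : ℕ} : ∀ (l : List (κ → ℚ)) {Δ : Fan ℚ (κ → ℚ)},
    Δ.IsPrimSimplicial → (∀ ρ ∈ Δ.cones, conePMult ρ ≤ m) →
    (∀ z ∈ l, IsPrimitive z ∧ ∃ σ ∈ Δ.cones, ∃ S : Finset (κ → ℚ), IsPrimGens σ S ∧
      conePMult σ = m ∧ ∃ a ∈ parCoeffs S, z = ∑ s ∈ S, a s • s) →
    l.Nodup → (∀ σ ∈ Δ.cones, ∀ z ∈ l, ∀ z' ∈ l, z ∈ σ → z' ∈ σ → z = z') →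
    (Δ.starIter l).IsPrimSimplicial ∧
      ∀ ρ' ∈ (Δ.starIter l).cones, conePMult ρ' ≤ m ∧
        (conePMult ρ' = m → ρ' ∈ Δ.cones ∧ ∀ z ∈ l, z ∉ ρ')
  | [], _, hΔ, hm, _, _, _ => ⟨hΔ, fun ρ' hρ' => ⟨hm ρ' hρ', fun _ => ⟨hρ', fun _ h => by simp at h⟩⟩⟩
  | z :: l, Δ, hΔ, hm, hZ, hnd, hsep => by
    have hzl : z ∉ l := (List.nodup_cons.mp hnd).1
    have hnd' : l.Nodup := (List.nodup_cons.mp hnd).2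
    obtain ⟨hzprim, σ, hσ, S, hS, hσm, a, ha, hza⟩ := hZ z List.mem_cons_self
    -- the first star subdivision, through `z`
    have hΔ' : (Δ.starSubdivision z).IsPrimSimplicial :=
      isPrimSimplicial_starSubdivision_of_isPrimitive hΔ hzprim
    have hstep : ∀ ρ' ∈ (Δ.starSubdivision z).cones, conePMult ρ' ≤ m ∧
        (conePMult ρ' = m → ρ' ∈ Δ.cones ∧ z ∉ ρ') := by
      intro ρ' hρ'
      have hw : IsPrimitive (∑ s ∈ S, a s • s) := hza ▸ hzprim
      have hρ'' : ρ' ∈ (Δ.starSubdivision (∑ s ∈ S, a s • s)).cones := hza ▸ hρ'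
      have := conePMult_starSubdivision_parPoint hΔ hm hσ hS hσm ha hw hρ''
      rwa [← hza] at this
    -- the later points keep their data (their cones avoid `z`)
    have hzz : ∀ z' ∈ l, ∀ σ' ∈ Δ.cones, z ∈ σ' → z' ∈ σ' → False := by
      intro z' hz' σ' hσ' hz hz'σ'
      have := hsep σ' hσ' z List.mem_cons_self z' (List.mem_cons_of_mem z hz') hz hz'σ'
      exact hzl (this ▸ hz')
    have hZ' : ∀ z' ∈ l, IsPrimitive z' ∧ ∃ σ' ∈ (Δ.starSubdivision z).cones,
        ∃ S' : Finset (κ → ℚ), IsPrimGens σ' S' ∧ conePMult σ' = m ∧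
          ∃ a' ∈ parCoeffs S', z' = ∑ s ∈ S', a' s • s := by
      intro z' hz'
      obtain ⟨hz'prim, σ', hσ', S', hS', hσ'm, a', ha', hz'a⟩ := hZ z' (List.mem_cons_of_mem z hz')
      have hz'σ' : z' ∈ σ' := by
        rw [hz'a, hS'.2.2]; exact sum_smul_mem_hull fun s hs => (ha'.1 s hs).1
      have hzσ' : z ∉ σ' := fun h => hzz z' hz' σ' hσ' h hz'σ'
      exact ⟨hz'prim, σ', mem_starCones_of_not_mem hσ' hzσ', S', hS', hσ'm, a', ha', hz'a⟩
    have hsep' : ∀ σ' ∈ (Δ.starSubdivision z).cones, ∀ z₁ ∈ l, ∀ z₂ ∈ l,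
        z₁ ∈ σ' → z₂ ∈ σ' → z₁ = z₂ := by
      intro σ' hσ' z₁ hz₁ z₂ hz₂ h₁ h₂
      obtain ⟨σ₀, hσ₀, hle⟩ := starSubdivision_exists_le hσ'
      exact hsep σ₀ hσ₀ z₁ (List.mem_cons_of_mem z hz₁) z₂ (List.mem_cons_of_mem z hz₂)
        (hle h₁) (hle h₂)
    obtain ⟨hps, hcnt⟩ := multiStep_parPoints l hΔ' (fun ρ' hρ' => (hstep ρ' hρ').1) hZ' hnd' hsep'
    rw [starIter_cons]
    refine ⟨hps, fun ρ' hρ' => ⟨(hcnt ρ' hρ').1, fun h => ?_⟩⟩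
    obtain ⟨hρ'1, hno⟩ := (hcnt ρ' hρ').2 h
    obtain ⟨hρ'Δ, hzρ'⟩ := (hstep ρ' hρ'1).2 h
    refine ⟨hρ'Δ, fun w hw => ?_⟩
    rcases List.mem_cons.mp hw with rfl | hw
    · exact hzρ'
    · exact hno w hw

/-- **The measure drops under a synchronised step** ([Ewald1996] VI Thm. 8.5, proof, globalised):
for a primitively simplicial `Δ` and a NONEMPTY separated duplicate-free list `l` of primitive
parallelotope points of cones of maximal count, the iterated star subdivision is primitively
simplicial and `(maxPMult, numMax)` decreases lexicographically (the cone of maximal count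
carrying the first point disappears and no cone of maximal count is created).
[cite: Ewald1996, VI Thm. 8.5] -/
theorem multiStep_measure_lt {Δ : Fan ℚ (κ → ℚ)} (hΔ : Δ.IsPrimSimplicial) {l : List (κ → ℚ)}
    (hl : l ≠ [])
    (hZ : ∀ z ∈ l, IsPrimitive z ∧ ∃ σ ∈ Δ.cones, ∃ S : Finset (κ → ℚ), IsPrimGens σ S ∧
      conePMult σ = Δ.maxPMult ∧ ∃ a ∈ parCoeffs S, z = ∑ s ∈ S, a s • s)
    (hnd : l.Nodup) (hsep : ∀ σ ∈ Δ.cones, ∀ z ∈ l, ∀ z' ∈ l, z ∈ σ → z' ∈ σ → z = z') :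
    (Δ.starIter l).IsPrimSimplicial ∧
      ((Δ.starIter l).maxPMult < Δ.maxPMult ∨
        ((Δ.starIter l).maxPMult = Δ.maxPMult ∧ (Δ.starIter l).numMax < Δ.numMax)) := by
  classical
  obtain ⟨hps, hcnt⟩ := multiStep_parPoints l hΔ (fun ρ hρ => conePMult_le_maxPMult hρ) hZ hnd hsep
  refine ⟨hps, ?_⟩
  set Δ' := Δ.starIter l with hΔ'
  have hM'le : Δ'.maxPMult ≤ Δ.maxPMult :=
    Finset.sup_le fun ρ' hρ' => (hcnt ρ' (Δ'.finite.mem_toFinset.mp hρ')).1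
  rcases hM'le.lt_or_eq with hlt | heq
  · exact Or.inl hlt
  · refine Or.inr ⟨heq, ?_⟩
    -- the first point and its maximal cone
    obtain ⟨z, hz⟩ := List.exists_mem_of_ne_nil l hl
    obtain ⟨-, σ, hσ, S, hS, hσM, a, ha, hza⟩ := hZ z hz
    have hzσ : z ∈ σ := by
      rw [hza, hS.2.2]; exact sum_smul_mem_hull fun s hs => (ha.1 s hs).1
    rw [numMax, numMax, heq]
    apply Finset.card_lt_card
    refine ⟨fun ρ' hρ' => ?_, fun hsub => ?_⟩
    · obtain ⟨hρ'fin, hρ'M⟩ := Finset.mem_filter.mp hρ'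
      obtain ⟨hρ'Δ, -⟩ := (hcnt ρ' (Δ'.finite.mem_toFinset.mp hρ'fin)).2 hρ'M
      exact Finset.mem_filter.mpr ⟨Δ.finite.mem_toFinset.mpr hρ'Δ, hρ'M⟩
    · have hσin : σ ∈ Δ.finite.toFinset.filter fun ρ => conePMult ρ = Δ.maxPMult :=
        Finset.mem_filter.mpr ⟨Δ.finite.mem_toFinset.mpr hσ, hσM⟩
      obtain ⟨hσfin', hσM'⟩ := Finset.mem_filter.mp (hsub hσin)
      obtain ⟨-, hno⟩ := (hcnt σ (Δ'.finite.mem_toFinset.mp hσfin')).2 hσM'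
      exact hno z hz hzσ

omit [DecidableEq κ] in
/-- **The choice behind one step** (first half of the proof of `Fan.exists_step`, exposed for the
synchronised loop): a primitively simplicial fan which is not regular has a cone `σ` of MAXIMAL
count with primitive simplicial generators `S` and a parallelotope coefficient vector `a` — not
identically zero on `S` — such that `w = Σ a_s s` is a PRIMITIVE lattice point of `σ` (normalise a
nonzero parallelotope point to the first lattice point of its ray). [cite: Ewald1996, VI Thm. 8.5] -/
theorem exists_parPoint_of_not_isRegular {Δ : Fan ℚ (κ → ℚ)} (hΔ : Δ.IsPrimSimplicial)
    (hnr : ¬ Δ.IsRegular) :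
    ∃ σ ∈ Δ.cones, ∃ S : Finset (κ → ℚ), IsPrimGens σ S ∧ conePMult σ = Δ.maxPMult ∧
      ∃ a ∈ parCoeffs S, IsPrimitive (∑ s ∈ S, a s • s) ∧ (∑ s ∈ S, a s • s) ∈ σ ∧
        ∃ j ∈ S, a j ≠ 0 := by
  classical
  -- a non-regular cone exists, so the maximal count is `≥ 2`
  obtain ⟨ρ, hρ, hρnr⟩ : ∃ ρ ∈ Δ.cones, ∀ S : Finset (κ → ℚ), IsPrimGens ρ S → ¬ IsRegularGens S := by
    by_contra hne
    push Not at hne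
    apply hnr
    intro ρ hρ
    obtain ⟨S, hS, hreg⟩ := hne ρ hρ
    exact ⟨S, hreg, hS.2.2⟩
  obtain ⟨Sρ, hSρ⟩ := hΔ.exists_isPrimGens hρ
  have hM2 : 2 ≤ Δ.maxPMult := by
    have h1 : pmult Sρ ≠ 1 := fun h =>
      hρnr Sρ hSρ (isRegularGens_of_pmult_eq_one hSρ.mem_latticeN hSρ.2.1 h)
    have h2 : 0 < pmult Sρ := pmult_pos hSρ.2.1
    have h3 := conePMult_le_maxPMult hρ
    rw [conePMult_eq hSρ] at h3
    omega
  -- a cone `σ` of maximal count, its generators, a parallelotope point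
  have hne : Δ.finite.toFinset.Nonempty := ⟨ρ, Δ.finite.mem_toFinset.mpr hρ⟩
  obtain ⟨σ, hσfin, hσmax⟩ := Finset.exists_mem_eq_sup Δ.finite.toFinset hne conePMult
  have hσ : σ ∈ Δ.cones := Δ.finite.mem_toFinset.mp hσfin
  obtain ⟨S, hS⟩ := hΔ.exists_isPrimGens hσ
  have hσM : pmult S = Δ.maxPMult := by rw [← conePMult_eq hS, ← hσmax]; rfl
  have hSnr : ¬ IsRegularGens S := fun h => by
    have := pmult_eq_one_of_isRegularGens h; omega
  obtain ⟨a, ha, j, hj, haj⟩ := exists_ne_zero_of_not_isRegularGens hS.mem_latticeN hS.2.1 hSnr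
  -- normalise to a primitive point
  set w₀ := ∑ s ∈ S, a s • s with hw₀
  have hw₀N : w₀ ∈ latticeN κ := ha.2.2
  have hw₀0 : w₀ ≠ 0 := by
    intro h0
    have hzero : ∑ s ∈ S, a s • s = ∑ s ∈ S, (0 : (κ → ℚ) → ℚ) s • s := by
      rw [← hw₀, h0]; simp
    exact haj (eq_on_of_sum_smul_eq hS.2.1 hzero j hj)
  obtain ⟨c, hc0, hc1, hprim⟩ := exists_isPrimitive_smul hw₀N hw₀0
  let a' : (κ → ℚ) → ℚ := fun s => c * a s
  have hw : ∑ s ∈ S, a' s • s = c • w₀ := by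
    rw [hw₀, Finset.smul_sum]
    exact Finset.sum_congr rfl fun s _ => by rw [smul_smul]
  have ha' : a' ∈ parCoeffs S := by
    refine ⟨fun s hs => ⟨mul_nonneg hc0.le (ha.1 s hs).1, ?_⟩, fun s hs => ?_, ?_⟩
    · calc c * a s ≤ 1 * a s := mul_le_mul_of_nonneg_right hc1 (ha.1 s hs).1
        _ < 1 := by rw [one_mul]; exact (ha.1 s hs).2
    · simp only [a', ha.2.1 s hs, mul_zero]
    · rw [hw]; exact hprim.1
  refine ⟨σ, hσ, S, hS, by rw [conePMult_eq hS, hσM], a', ha', hw ▸ hprim, ?_, j, hj,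
    mul_ne_zero hc0.ne' haj⟩
  rw [hS.2.2]
  exact sum_smul_mem_hull fun s hs => (ha'.1 s hs).1

omit [DecidableEq κ] in
/-- Iterated star subdivisions through nonzero vectors of the support refine the fan.
[cite: Fulton1993Toric, §2.6 p. 47] -/
theorem starIter_refines_of_mem_support : ∀ (l : List (κ → ℚ)) {Δ : Fan ℚ (κ → ℚ)},
    (∀ w ∈ l, w ∈ Δ.support) → (∀ w ∈ l, w ≠ 0) → (Δ.starIter l).Refines Δ
  | [], Δ, _, _ => Refines.refl Δ
  | w :: l, Δ, hs, h0 => by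
    rw [starIter_cons]
    have hw : w ∈ Δ.support := hs w List.mem_cons_self
    have hw0 : w ≠ 0 := h0 w List.mem_cons_self
    have hstep := (starSubdivision_refines hw hw0).1
    have hs' : ∀ v ∈ l, v ∈ (Δ.starSubdivision w).support := fun v hv => by
      rw [starSubdivision_support hw0]; exact hs v (List.mem_cons_of_mem w hv)
    exact (starIter_refines_of_mem_support l hs' fun v hv => h0 v (List.mem_cons_of_mem w hv)).trans
      hstep

/-- **The synchronised regularisation loop, abstract form** ([Ewald1996] VI Thm. 8.5 / [KempfEtAl1973]
II §2, induction on `(maxPMult, numMax)`): let `I` be any property of fans (in the application: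
"link-compatible and carrying a link-invariant order function"). If from every primitively
simplicial, NON-regular fan satisfying `I` one can produce a nonempty duplicate-free SEPARATED list
of primitive parallelotope points of cones of maximal count (in the application: the link-orbit of
ONE such point) such that the iterated star subdivision through it again satisfies `I`, then some
iterated star subdivision of `Δ` through nonzero lattice vectors is REGULAR, primitively
simplicial, refines `Δ`, and satisfies `I`. The one-step hypothesis is all that the links have to
supply. [cite: Ewald1996, VI Thm. 8.5] -/
theorem exists_regular_starIter_of_invariant {I : Fan ℚ (κ → ℚ) → Prop}
    (step : ∀ Γ : Fan ℚ (κ → ℚ), I Γ → Γ.IsPrimSimplicial → ¬ Γ.IsRegular →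
      ∃ l : List (κ → ℚ), l ≠ [] ∧ l.Nodup ∧
        (∀ z ∈ l, IsPrimitive z ∧ ∃ σ ∈ Γ.cones, ∃ S : Finset (κ → ℚ), IsPrimGens σ S ∧
          conePMult σ = Γ.maxPMult ∧ ∃ a ∈ parCoeffs S, z = ∑ s ∈ S, a s • s) ∧
        (∀ σ ∈ Γ.cones, ∀ z ∈ l, ∀ z' ∈ l, z ∈ σ → z' ∈ σ → z = z') ∧ I (Γ.starIter l))
    {Δ : Fan ℚ (κ → ℚ)} (hI : I Δ) (hΔ : Δ.IsPrimSimplicial) :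
    ∃ L : List (κ → ℚ), (∀ w ∈ L, w ∈ latticeN κ ∧ w ≠ 0) ∧ (Δ.starIter L).Refines Δ ∧
      (Δ.starIter L).IsRegular ∧ (Δ.starIter L).IsPrimSimplicial ∧ I (Δ.starIter L) := by
  suffices h : ∀ M N : ℕ, ∀ Δ : Fan ℚ (κ → ℚ), I Δ → Δ.IsPrimSimplicial → Δ.maxPMult = M →
      Δ.numMax = N → ∃ L : List (κ → ℚ), (∀ w ∈ L, w ∈ latticeN κ ∧ w ≠ 0) ∧
        (Δ.starIter L).Refines Δ ∧ (Δ.starIter L).IsRegular ∧ (Δ.starIter L).IsPrimSimplicial ∧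
        I (Δ.starIter L) from h _ _ Δ hI hΔ rfl rfl
  intro M
  induction M using Nat.strong_induction_on with
  | _ M ihM =>
    intro N
    induction N using Nat.strong_induction_on with
    | _ N ihN =>
      intro Δ hI hΔ hM hN
      by_cases hreg : Δ.IsRegular
      · exact ⟨[], fun _ h => absurd h List.not_mem_nil, Refines.refl Δ, hreg, hΔ, hI⟩
      · obtain ⟨l, hlne, hlnd, hZ, hsep, hI'⟩ := step Δ hI hΔ hreg
        obtain ⟨hΔ', hlex⟩ := multiStep_measure_lt hΔ hlne hZ hlnd hsep
        have hl0 : ∀ w ∈ l, w ∈ latticeN κ ∧ w ≠ 0 := fun w hw => ⟨(hZ w hw).1.1, (hZ w hw).1.2.1⟩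
        -- the points lie in the support, so each step refines
        have hlsupp : ∀ w ∈ l, w ∈ Δ.support := by
          intro w hw
          obtain ⟨-, σ, hσ, S, hS, -, a, ha, hwa⟩ := hZ w hw
          refine mem_support.mpr ⟨σ, hσ, ?_⟩
          rw [hwa, hS.2.2]; exact sum_smul_mem_hull fun s hs => (ha.1 s hs).1
        have hstep : (Δ.starIter l).Refines Δ :=
          starIter_refines_of_mem_support l hlsupp fun w hw => (hl0 w hw).2
        obtain ⟨L, hL, href, hreg', hps', hI''⟩ : ∃ L : List (κ → ℚ), (∀ w ∈ L, w ∈ latticeN κ ∧ w ≠ 0) ∧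
            ((Δ.starIter l).starIter L).Refines (Δ.starIter l) ∧
            ((Δ.starIter l).starIter L).IsRegular ∧ ((Δ.starIter l).starIter L).IsPrimSimplicial ∧
            I ((Δ.starIter l).starIter L) := by
          rcases hlex with h1 | ⟨h1, h2⟩
          · exact ihM _ (hM ▸ h1) _ _ hI' hΔ' rfl rfl
          · exact ihN _ (hN ▸ h2) _ hI' hΔ' (h1.trans hM) rfl
        refine ⟨l ++ L, fun v hv => ?_, ?_, ?_, ?_, ?_⟩
        · rcases List.mem_append.mp hv with hv | hv
          · exact hl0 v hv
          · exact hL v hv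
        · rw [starIter_append]; exact href.trans hstep
        · rw [starIter_append]; exact hreg'
        · rw [starIter_append]; exact hps'
        · rw [starIter_append]; exact hI''

end Step

end Fan

end Literature.Geometry.PolyhedralFans

end
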